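import Summits.BirchSwinnertonDyer.BirchSwinnertonDyer.Theorems.ManinLocalTwoThreeKummerMinimalDictionaryPrelims
import Summits.BirchSwinnertonDyer.BirchSwinnertonDyer.Theorems.ManinLocalTwoThreeKummerWitnessInvarianceDensity
import Summits.BirchSwinnertonDyer.BirchSwinnertonDyer.Theorems.ManinLocalTwoThreeMinimalCubeRootIntegral
import HarnessLib

/-!
# (DICT) PROVED: the formal ↔ analytic dictionary for the MINIMAL cube root — `Σ gₙqⁿ = κ·(t_W∘φ)·W_{u,e}(c·E_f)`
(route `ManinLocalTwoThree`, crux C3 `ManinPrimeToThreeAtNine` stmt-BirchSwinnertonDyer-22968; cell bsd-f2-manin, C3 LEAD p1 gen 16;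
`--supports stmt-BirchSwinnertonDyer-22968`; piece (DICT) of -an g38's typed witness line `ManinAdditive/UDCKummerWitnessLine.lean`, p729921,
consumed by BOTH compositions `kummerCubeRootModularFormWitnessNearCusp_of_pieces` (P(j)-line) and `…_of_piecesB` (B-line))

**`kummerMinimalDictionary_holds : UDCKummerWitnessLine.KummerMinimalDictionary`.**  For a globally minimal `W`, a datum `D` (`c = D.c`),
integer newform coefficients `a`, a `3`-torsion point `(X₀, Y₀)` of the short model, ANY lift `u ∉ Λ` of it (`c²℘(u) = X₀`, `c³℘'(u)/2 = Y₀`)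
with `3u = m₁ω₁ + m₂ω₂`, THE short germ `z`, any formal cube root `h` of `Θ_T(z)` with `h(0) = −1`, and any `g` with `c·(z·g) = z_W·h`
(`z_W = exp_W(c·Σaₙqⁿ/n)` the germ of the minimal model): there are `κ ≠ 0` and `B` such that for `Im τ > B` one has `c·E_f(τ) ∉ Λ`,
`(y_W∘φ)(τ) ≠ 0` and `Σ gₙ 𝕢₁(τ)ⁿ = κ · kummerMinBlock D u (m₁η₁ + m₂η₂) τ` (`HasSum`).

Proof (all engines in the tree; §1–§2 are the sibling file `…KummerMinimalDictionaryPrelims.lean`).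
* §1 `exists_hasSum_const_mul_shortT_mul_sigmaCubeRoot_of_lift` — p2's (AN2-b) `KummerCubeRootDictionary.exists_hasSum_const_mul_shortT_mul_sigmaCubeRoot`
  (p727852) RE-RUN FOR A GIVEN LIFT `u` (the landed statement produces its own lift by S6; the proof — S3 `sigmaTangentLineIdentity`, S3′
  `tangentLineScaling`, `exists_analytic_shortT_mul_sigmaCubeRoot`, (AN2-a) `exists_hasSum_cubeRoot_kummerCubeSeries`, formal uniqueness of cube
  roots — uses of the lift only `u ∉ Λ`, `3u ∈ Λ`, the two coordinates and `℘'(u) ≠ 0`, the last from `2u, 3u ∈ Λ ⇒ u ∈ Λ`):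
  `Σ hₙqⁿ = κ₀·t_s·W_{u,e}(w)`, `w = c·E_f(τ)`, `κ₀ ≠ 0`.
* §2 the two PARAMETER DICTIONARIES as analytic `q`-germs with identified Taylor series: `Z = t∘(c⁻¹Λ, E_{W,c}) ∘ ε` has `𝓣[Z] = z`
  and `Z(𝕢₁τ) = t_s(τ)`; `Z_W = t∘(Λ, W) ∘ (c·ε)` has `𝓣[Z_W] = z_W` and `Z_W(𝕢₁τ) = (t_W∘φ)(τ) = minimalParam D τ` off `φ⁻¹(O)`
  (`taylorAt0_locT` = the tree's `taylor_localParam_eq_formalExp`, `taylorAt0_comp`, `taylorAt0_qGerm`, `isNeron_shortModel` / `D.isNeronLattice`).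
* §3 assembly: `Z = q·Z₁`, `Z_W = q·Z₁'` (`dslope`; `Z₁(0) = z₁ = 1`), `H` the analytic germ of `Σhₙqⁿ` (`exists_analyticAt_of_hasSum_qParam`);
  the germ `𝒢 = Z₁'·H/(c·Z₁)` is analytic at `0`, and `q·(c·Z₁·𝒢) = q·(Z₁'·H)` gives `c·z·𝓣[𝒢] = z_W·h = c·z·g` in the domain `ℂ⟦q⟧`, so `𝓣[𝒢] = g`
  and `Σ gₙqⁿ → 𝒢(q)` on a ball (`exists_hasSum_taylorAt0`); high in the strip `𝒢(𝕢₁τ) = t_W·(κ₀ t_s W)/(c·t_s) = (κ₀/c)·t_W·W = (κ₀/c)·kummerMinBlock`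
  (`t_s ≠ 0` there since `Z₁ → 1`).  The side conditions `w ∉ Λ`, `y_W∘φ ≠ 0` high in the strip: p2's `WitnessInvariance.exists_minimal_package`
  (`minimalY = (c³/2)·Q(w)/σ(w)³`, `Q` entire, `Q(0) = −2`) and `eventually_smul_qGerm_notMem`.
HONEST FRAMING.  One more typed piece of the (AN) witness law is a theorem ((INT) p728452, (QEXN) p730250, (QXP) p730253, (INV) p731378 are the
others); (ALG) and (EXT) (or the B-line's (RATB)/(HOLB)/(INVB)) remain, as do F₃♮, CDT, RES₃♭.  BSD is not proved by this; Manin's conjecture is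
not proved; C2 and C3 remain OPEN.  No definitions, no sorry.
[folklore] [cite: SilvermanAEC2009, IV.1 (the local parameter `z = −x/y` and its formal expansion) and VI.3 (σ-function)]
-/

set_option autoImplicit false
-- lint-debt: the directory name repeats the summit name (sibling precedent `ManinLocalTwoThreeKummerWitnessInvariance.lean`)
set_option linter.dupNamespace false

noncomputable section

open scoped Topology PeriodPair
open Complex Filter PowerSeries
open UpperHalfPlane hiding I
open WeierstrassCurve Literature.NumberTheory.EllipticCurves Literature.NumberTheory.EllipticCurves.ModularForms
open Summit.BirchSwinnertonDyer.Rank1Residual.ManinAdditive.CuspidalKummer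
open Summit.BirchSwinnertonDyer.Rank1Residual.ManinAdditive.CuspidalKummerThree
open Summit.BirchSwinnertonDyer.Rank1Residual.ManinAdditive.KummerCubeMonodromy
open Summit.BirchSwinnertonDyer.Rank1Residual.ManinAdditive.UDCKummerWitnessLine
open Summit.BirchSwinnertonDyer.BirchSwinnertonDyer.Theorems.ManinLocalTwoThree.KummerCubeAnalytic
open Summit.BirchSwinnertonDyer.BirchSwinnertonDyer.Theorems.ManinLocalTwoThree.KummerCubeSigmaLeaves
open Summit.BirchSwinnertonDyer.BirchSwinnertonDyer.Theorems.ManinLocalTwoThree.KummerCubeRootDictionary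

namespace Summit.BirchSwinnertonDyer.BirchSwinnertonDyer.Theorems.ManinLocalTwoThree.MinimalDictionary
/-! ### §3 (DICT) by name -/

/-- `𝓣[q ↦ q·F(q)] = X·𝓣[F]` for `F` analytic at `0`. [folklore] -/
theorem taylorAt0_id_mul {F : ℂ → ℂ} (hF : AnalyticAt ℂ F 0) :
    taylorAt0 (fun q => q * F q) = X * taylorAt0 F := by
  have hid : AnalyticAt ℂ (fun z : ℂ => z) 0 := analyticAt_id
  have h := taylorAt0_mul hid hF
  rw [taylorAt0_id] at h
  exact h

/-- The `dslope` factorisation of a germ vanishing at `0`: `Z = q·Z₁` with `Z₁ = dslope Z 0` analytic at `0` and `𝓣[Z] = X·𝓣[Z₁]`. [folklore] -/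
theorem exists_dslope_factor {Z : ℂ → ℂ} (hZ : AnalyticAt ℂ Z 0) (hZ0 : Z 0 = 0) :
    ∃ Z₁ : ℂ → ℂ, AnalyticAt ℂ Z₁ 0 ∧ (∀ q, Z q = q * Z₁ q) ∧ taylorAt0 Z = X * taylorAt0 Z₁ := by
  have hZ₁ : AnalyticAt ℂ (dslope Z 0) 0 := by
    obtain ⟨p, hp⟩ := hZ
    exact ⟨_, hp.has_fpower_series_dslope_fslope⟩
  have hfac : ∀ q, Z q = q * dslope Z 0 q := fun q => by
    have h := sub_smul_dslope Z 0 q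
    rw [sub_zero, smul_eq_mul, hZ0, sub_zero] at h
    exact h.symm
  refine ⟨dslope Z 0, hZ₁, hfac, ?_⟩
  rw [← taylorAt0_id_mul hZ₁]
  exact congrArg taylorAt0 (funext hfac)

/-- **(DICT) `KummerMinimalDictionary` holds.**  See the file header. [folklore] -/
theorem kummerMinimalDictionary_holds : KummerMinimalDictionary := by
  intro W _ _ N _ D a ha X₀ Y₀ _hT u hu m₁ m₂ hm hX hY z hz h hh3 hh0 g hg
  have hc0 : D.c ≠ 0 := D.maninConstant_ne_zero_holds
  have hc : (D.c : ℂ) ≠ 0 := Int.cast_ne_zero.mpr hc0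
  set zWq : ℚ⟦X⟧ := W.formalExp.subst ((D.c : ℚ) • lSeriesLog a) with hzWq
  set e : ℂ := m₁ * D.L.η₁ + m₂ * D.L.η₂ with he
  -- §1: `Σ hₙqⁿ = κ₀·t_s·W`
  obtain ⟨κ₀, B₁, hκ₀, hH⟩ :=
    exists_hasSum_const_mul_shortT_mul_sigmaCubeRoot_of_lift W D a ha X₀ Y₀ hu hm hX hY z hz h hh3 hh0
  -- the analytic germ `H` of `Σ hₙqⁿ`
  set hC : PowerSeries ℂ := h.map (algebraMap ℚ ℂ) with hhC
  have hcoefh : ∀ n, coeff n hC = ((coeff n h : ℚ) : ℂ) := fun n => by rw [hhC, coeff_map, eq_ratCast]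
  have hH' : ∀ τ : ℍ, B₁ < τ.im → HasSum (fun n : ℕ => coeff n hC * Function.Periodic.qParam 1 (τ : ℂ) ^ n)
      (κ₀ * (shortT D τ * sigmaCubeRoot D.L u e ((D.c : ℂ) * eichlerIntegral D.f τ))) := by
    intro τ hτ; simpa only [hcoefh] using hH τ hτ
  obtain ⟨H, hHan, hTH, B₂, hHval⟩ := exists_analyticAt_of_hasSum_qParam hH'
  -- §2: the two parameter germs and their `dslope` factorisations
  obtain ⟨Z, hZan, hZ0, hTZ, B₃, hZval⟩ := exists_qGerm_shortT W D a ha hc0 z hz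
  obtain ⟨ZW, hZWan, hZW0, hTZW, hZWval⟩ := exists_qGerm_minimalParam W D a ha hc0
  obtain ⟨Z₁, hZ₁an, hZfac, hTZ₁⟩ := exists_dslope_factor hZan hZ0
  obtain ⟨ZW₁, hZW₁an, hZWfac, hTZW₁⟩ := exists_dslope_factor hZWan hZW0
  -- `Z₁(0) = z₁ = 1`
  have hz1 : coeff 1 z = 1 := MinimalCubeRoot.coeff_one_shortGerm W D a ha hz
  have hZ₁0 : Z₁ 0 = 1 := by
    have h1 := congrArg (coeff 1) hTZ₁
    rw [hTZ, coeff_map, hz1, map_one, show (1 : ℕ) = 0 + 1 from rfl, coeff_succ_X_mul,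
      coeff_zero_eq_constantCoeff_apply, constantCoeff_taylorAt0] at h1
    exact h1.symm
  -- the germ `𝒢 = ZW₁·H/(c·Z₁)`
  set 𝒢 : ℂ → ℂ := fun q => ZW₁ q * H q / ((D.c : ℂ) * Z₁ q) with h𝒢
  have hden0 : (D.c : ℂ) * Z₁ 0 ≠ 0 := by rw [hZ₁0, mul_one]; exact hc
  have h𝒢an : AnalyticAt ℂ 𝒢 0 := (hZW₁an.mul hHan).div (analyticAt_const.mul hZ₁an) hden0
  -- `𝓣[𝒢] = g`: from `𝒢·(c·Z₁) = ZW₁·H` near `0`, times `X`, and the formal relation `c·z·g = z_W·h`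
  have hZ₁ne : ∀ᶠ q in 𝓝 (0 : ℂ), (D.c : ℂ) * Z₁ q ≠ 0 :=
    (analyticAt_const.mul hZ₁an).continuousAt.eventually_ne hden0
  have hprod : taylorAt0 𝒢 * (C (D.c : ℂ) * taylorAt0 Z₁) = taylorAt0 ZW₁ * taylorAt0 H := by
    have h1 : taylorAt0 (fun q => 𝒢 q * ((D.c : ℂ) * Z₁ q)) = taylorAt0 (fun q => ZW₁ q * H q) := by
      apply taylorAt0_congr
      filter_upwards [hZ₁ne] with q hq
      rw [h𝒢]
      simp only
      rw [div_mul_cancel₀ _ hq]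
    have h2 : taylorAt0 (fun q => 𝒢 q * ((D.c : ℂ) * Z₁ q)) = taylorAt0 𝒢 * (C (D.c : ℂ) * taylorAt0 Z₁) := by
      have hcz : taylorAt0 (fun q => (D.c : ℂ) * Z₁ q) = C (D.c : ℂ) * taylorAt0 Z₁ :=
        Literature.NumberTheory.Transcendental.AndreCriterion.taylor_const_mul (D.c : ℂ) Z₁
      rw [← hcz]
      exact taylorAt0_mul h𝒢an (analyticAt_const.mul hZ₁an)
    have h3 : taylorAt0 (fun q => ZW₁ q * H q) = taylorAt0 ZW₁ * taylorAt0 H := taylorAt0_mul hZW₁an hHan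
    rw [← h2, h1, h3]
  have hT𝒢 : taylorAt0 𝒢 = g.map (algebraMap ℚ ℂ) := by
    -- the formal relation, base-changed: `C c · z · g = z_W · h`
    have hrel : C (D.c : ℂ) * z.map (algebraMap ℚ ℂ) * g.map (algebraMap ℚ ℂ) =
        PowerSeries.map (algebraMap ℚ ℂ) zWq * hC := by
      have h := congrArg (PowerSeries.map (algebraMap ℚ ℂ)) hg
      rw [smul_eq_C_mul, map_mul, map_mul, map_mul, PowerSeries.map_C, eq_ratCast, Rat.cast_intCast] at h
      rw [hhC, ← h, mul_assoc]
    -- `C c · z · 𝓣[𝒢] = z_W · h` from `hprod` times `X`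
    have hrel' : C (D.c : ℂ) * z.map (algebraMap ℚ ℂ) * taylorAt0 𝒢 =
        PowerSeries.map (algebraMap ℚ ℂ) zWq * hC := by
      rw [← hTZ, ← hTZW, ← hTH, hTZ₁, hTZW₁]
      linear_combination X * hprod
    have hzne : C (D.c : ℂ) * z.map (algebraMap ℚ ℂ) ≠ 0 := by
      refine mul_ne_zero ?_ ?_
      · intro h0
        have := congrArg constantCoeff h0
        rw [constantCoeff_C, map_zero] at this
        exact hc this
      · intro h0
        have := congrArg (coeff 1) h0
        rw [coeff_map, hz1, map_one, map_zero] at this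
        exact one_ne_zero this
    have := hrel'.trans hrel.symm
    rw [mul_comm (C (D.c : ℂ) * z.map (algebraMap ℚ ℂ)) (taylorAt0 𝒢),
      mul_comm (C (D.c : ℂ) * z.map (algebraMap ℚ ℂ))] at this
    exact mul_right_cancel₀ hzne this
  -- `Σ gₙqⁿ → 𝒢(q)` on a ball
  obtain ⟨r, hr, hsum⟩ := exists_hasSum_taylorAt0 h𝒢an
  -- side conditions high in the strip: `w ∉ Λ`, `Q(w) ≠ 0` (so `y_W∘φ ≠ 0`), `Z₁(q) ≠ 0`, `‖q‖ < r`
  obtain ⟨Q, A, hQd, -, hQ0, -, hYQ, -⟩ := WitnessInvariance.exists_minimal_package D hc0 u e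
  have hf1 : cuspCoeff D.f 1 = 1 := by
    rw [D.isNewformOf.2 1, W.isMultiplicative_LFunction.map_one]; simp
  have hσ : Differentiable ℂ D.L.weierstrassSigma := D.L.differentiable_weierstrassSigma_holds
  obtain ⟨B₄, hB₄⟩ := exists_im_bound_of_eventually
    (eventually_smul_qGerm_notMem D.f hf1 D.L hc hQd.continuous.continuousAt (by rw [hQ0]; norm_num))
  have hev5 : ∀ᶠ q in 𝓝[≠] (0 : ℂ), Z₁ q ≠ 0 ∧ ‖q‖ < r := by
    have h1 : ∀ᶠ q in 𝓝 (0 : ℂ), Z₁ q ≠ 0 := hZ₁an.continuousAt.eventually_ne (by rw [hZ₁0]; exact one_ne_zero)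
    have h2 : ∀ᶠ q in 𝓝 (0 : ℂ), ‖q‖ < r := by
      have : Metric.ball (0 : ℂ) r ∈ 𝓝 (0 : ℂ) := Metric.ball_mem_nhds 0 hr
      filter_upwards [this] with q hq
      rwa [Metric.mem_ball, dist_zero_right] at hq
    exact (h1.and h2).filter_mono nhdsWithin_le_nhds
  obtain ⟨B₅, hB₅⟩ := exists_im_bound_of_eventually hev5
  -- assemble
  refine ⟨κ₀ / (D.c : ℂ), div_ne_zero hκ₀ hc, max (max B₂ B₃) (max B₄ B₅), fun τ hτ => ?_⟩
  have h23 : max B₂ B₃ < τ.im := (le_max_left _ _).trans_lt hτ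
  have h45 : max B₄ B₅ < τ.im := (le_max_right _ _).trans_lt hτ
  have h2 : B₂ < τ.im := (le_max_left _ _).trans_lt h23
  have h3 : B₃ < τ.im := (le_max_right _ _).trans_lt h23
  have h4 : B₄ < τ.im := (le_max_left _ _).trans_lt h45
  have h5 : B₅ < τ.im := (le_max_right _ _).trans_lt h45
  set q : ℂ := Function.Periodic.qParam 1 (τ : ℂ) with hq
  set w : ℂ := (D.c : ℂ) * eichlerIntegral D.f τ with hw
  obtain ⟨hwΛ, hQw⟩ := hB₄ τ h4
  rw [qGerm_apply] at hwΛ hQw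
  obtain ⟨hZ₁q, hqr⟩ := hB₅ τ h5
  have hσw : D.L.weierstrassSigma w ≠ 0 := fun h0 => hwΛ ((D.L.weierstrassSigma_eq_zero_iff_holds w).mp h0)
  have hYne : minimalY D τ ≠ 0 := by
    rw [hYQ τ hwΛ]
    exact div_ne_zero (mul_ne_zero (div_ne_zero (pow_ne_zero 3 hc) two_ne_zero) hQw) (pow_ne_zero 3 hσw)
  refine ⟨hwΛ, hYne, ?_⟩
  -- the value `𝒢(q) = (κ₀/c)·t_W·W`
  have hq0 : q ≠ 0 := by
    rw [hq, ← norm_pos_iff, Function.Periodic.norm_qParam]; exact Real.exp_pos _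
  have htne : shortT D τ ≠ 0 := by
    rw [← hZval τ h3, hZfac]; exact mul_ne_zero hq0 hZ₁q
  have hval : 𝒢 q = κ₀ / (D.c : ℂ) * kummerMinBlock D u e τ := by
    have hZW₁q : ZW₁ q = minimalParam D τ / q := by
      rw [eq_div_iff hq0, mul_comm, ← hZWfac]; exact hZWval τ hwΛ
    have hZ₁q' : Z₁ q = shortT D τ / q := by
      rw [eq_div_iff hq0, mul_comm, ← hZfac]; exact hZval τ h3
    rw [h𝒢]
    simp only
    rw [hZW₁q, hZ₁q', hHval τ h2, kummerMinBlock, ← hw]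
    field_simp
  have hs := hsum q hqr
  rw [hT𝒢, hval] at hs
  have hfun : (fun n : ℕ => ((coeff n g : ℚ) : ℂ) * q ^ n) =
      fun n : ℕ => coeff n (g.map (algebraMap ℚ ℂ)) * q ^ n := by
    funext n; rw [coeff_map, eq_ratCast]
  rw [hfun]
  exact hs

/-- **(DICT) under the C3 skeleton's registered stub header** (`stub_kummerMinimalDictionary`, skeleton v25/v26 of line `kato_shift_three`,
verbatim signature; = `kummerMinimalDictionary_holds`). [folklore] -/
theorem stub_kummerMinimalDictionary : KummerMinimalDictionary := kummerMinimalDictionary_holds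

end Summit.BirchSwinnertonDyer.BirchSwinnertonDyer.Theorems.ManinLocalTwoThree.MinimalDictionary

end
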